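import Literature.RepresentationTheory.MatsushimaMultiplicityLeOne
import Mathlib.LinearAlgebra.DirectSum.Finsupp
import Mathlib.LinearAlgebra.Basis.VectorSpace
import HarnessLib

/-!
# Multiplicity at most one in a Matsushima-type decomposition — the bound is only needed
# on the summands isomorphic to the tested representation

Topic `RepresentationTheory`; theorems only (no definition, no named fact, no instance).

★ `Literature.RepresentationTheory.MatsushimaMultiplicity.rank_intertwiningMap_le_one_of_equivariant_directSum_tensor`
(`MatsushimaMultiplicityLeOne.lean`) proves: if `H ≅ ⨁ p, (M p ⊗ W p)` `G`-equivariantly (trivial action on the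
multiplicity spaces `M p`, irreducible admissible pairwise non-isomorphic `σ p` on `W p`), `rank M p ≤ 1` for EVERY
`p`, `G` has a compact open subgroup and `k = k̄`, then `rank Hom_G(ρ, H) ≤ 1` for every irreducible `ρ`.  This file
SHARPENS the hypothesis to the summands that matter: `rank M p ≤ 1` is required only for the indices `p` with
`σ p ≅ ρ` — an intertwiner out of the irreducible `ρ` has ZERO component in every summand `M q ⊗ W q ≅ (W q)^{⊕ dim M q}`
with `W q ≇ ρ`, whatever the multiplicity space `M q` (Schur's lemma, [Bump1997, Prop. 4.2.4] ∕ [Lang2002, Ch. XVII §1 Prop. 1.1]).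
In Matsushima's formula `H¹ = ⨁_{π_f} (⨁_{π_∞} H¹(𝔤,K;π_∞)^{⊕ m(π_∞ ⊗ π_f)}) ⊗ π_f` [BorelWallach2000, VII 3.2∕3.4]
this is the reading actually consumed by a multiplicity-one statement AT a given finite part `π_f ≅ ρ`
(«`Σ_{π_∞} m(π_∞ ⊗ π_f) · dim H¹(𝔤,K;π_∞) ≤ 1` for THAT `π_f`», e.g. for the members of one theta ∕ endoscopic packet,
[Rogawski1990, Thm. 14.6.4]) — no statement about the other constituents of `H¹` is needed.

## Content (namespace `Literature.RepresentationTheory.MatsushimaMultiplicity`)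

* `intertwiningMap_tprod_trivial_eq_zero` — Schur into a multiple: `ρ`, `σ` irreducible, `ρ ≇ σ` ⟹ every
  intertwiner `ρ → 1_M ⊗ σ` is `0` (any `k`-module `M`, `k` a field).
* `lift_rank_intertwiningMap_le_of_restrict` — for `H ≅ ⨁ p, E p` equivariantly and a set of indices `S` such that
  every intertwiner from the irreducible `ρ` to a summand off `S` vanishes, restriction to the summands in `S` is
  injective on `Hom_G(ρ, H)`: `rank Hom_G(ρ, H) ≤ rank Hom_G(ρ, ⨁_{p ∈ S} E p)` (universe-lifted).
* `rank_intertwiningMap_le_one_of_equivariant_directSum_tensor_of_equiv` — **the sharpened multiplicity lemma**: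
  as the ★ socket, with `hM : ∀ p, Nonempty ((σ p).Equiv ρ) → Module.rank k (M p) ≤ 1`.
* `finrank_intertwiningMap_le_one_of_equivariant_directSum_tensor_of_equiv` — the `finrank` form.

Cell `hodgecm-mathlib` (D-0151), FLOOR-0 programme P3 (the `hJ3a` fold; scope audit part 1 §4 (b)); count-neutral.
HC_CM is proved only modulo the 7 printed citations until rung 0 closes; this file discharges none of them.

## References
* [BorelWallach2000] A. Borel, N. Wallach, *Continuous cohomology, discrete subgroups, and representations of
  reductive groups*, 2nd ed., AMS 2000 — Ch. VII, Thm. 3.2 and Cor. 3.4 (Matsushima's formula).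
* [Bump1997] D. Bump, *Automorphic Forms and Representations*, CUP 1997 — Prop. 4.2.4 (Schur's lemma for
  irreducible admissible representations) and §4.2.
* [Rogawski1990] J. Rogawski, *Automorphic representations of unitary groups in three variables*, Ann. of Math.
  Stud. 123 (1990) — Thm. 14.6.4 (`m(π) ∈ {0,1}` on the packets of the inner forms).
* [Lang2002] S. Lang, *Algebra*, GTM 211, Springer 2002 — Ch. XVII §1, Prop. 1.1 (Schur's lemma).
-/

noncomputable section

open scoped DirectSum TensorProduct

namespace Literature.RepresentationTheory

namespace MatsushimaMultiplicity

universe uk uG uV uH uP uE uM uW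

variable {k : Type uk} [Field k] {G : Type uG} [Group G]

/-! ### Schur into a multiple `1_M ⊗ σ` -/

section SchurMultiple

variable {M : Type uM} [AddCommGroup M] [Module k M] {W : Type uW} [AddCommGroup W] [Module k W]
  (σ : Representation k G W)
variable {V : Type uV} [AddCommGroup V] [Module k V] {ρ : Representation k G V}

/-- `1_M ⊗ σ` acts by `id_M ⊗ σ(g)`. [folklore] -/
private theorem trivial_tprod_apply (g : G) (x : M ⊗[k] W) :
    ((Representation.trivial k G M).tprod σ) g x = LinearMap.lTensor M (σ g) x := by
  rw [Representation.tprod_apply]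
  rfl

/-- Coordinates along a basis `b` of `M`: the isomorphism `M ⊗ W ≅ ⊕_ι W`, `m ⊗ w ↦ (b*_i(m) • w)_i`, evaluated
on pure tensors. [folklore] -/
private theorem coordEquiv_tmul_apply {ι : Type*} [DecidableEq ι] (b : Module.Basis ι k M) (i : ι) (m : M)
    (w : W) :
    ((TensorProduct.congr b.repr (LinearEquiv.refl k W)).trans (TensorProduct.finsuppScalarLeft k W ι))
        (m ⊗ₜ w) i = b.repr m i • w := by
  simp only [LinearEquiv.trans_apply, TensorProduct.congr_tmul, LinearEquiv.refl_apply,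
    TensorProduct.finsuppScalarLeft_apply_tmul_apply]

/-- The coordinates along a basis of `M` intertwine `1_M ⊗ σ` (i.e. `id_M ⊗ σ(g)`) with `σ`. [folklore] -/
private theorem coordEquiv_lTensor_apply {ι : Type*} [DecidableEq ι] (b : Module.Basis ι k M) (i : ι)
    (g : G) (x : M ⊗[k] W) :
    ((TensorProduct.congr b.repr (LinearEquiv.refl k W)).trans (TensorProduct.finsuppScalarLeft k W ι))
        (LinearMap.lTensor M (σ g) x) i =
      σ g (((TensorProduct.congr b.repr (LinearEquiv.refl k W)).trans
        (TensorProduct.finsuppScalarLeft k W ι)) x i) := by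
  induction x using TensorProduct.induction_on with
  | zero => simp only [map_zero, Finsupp.zero_apply]
  | tmul m w => rw [LinearMap.lTensor_tmul, coordEquiv_tmul_apply, coordEquiv_tmul_apply, map_smul]
  | add x y hx hy => simp only [map_add, Finsupp.add_apply, hx, hy]

/-- **Schur's lemma into a multiple.**  Let `ρ` and `σ` be irreducible representations of `G` over a field `k`
with `ρ ≇ σ`, and `M` any `k`-vector space.  Then every intertwiner `ρ → 1_M ⊗ σ` (into `M ⊗ W ≅ W^{⊕ dim M}`,
`G` acting through `σ`) is zero: its coordinates along a basis of `M` are intertwiners `ρ → σ` between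
non-isomorphic irreducibles. [cite: Bump1997, Proposition 4.2.4] -/
theorem intertwiningMap_tprod_trivial_eq_zero [ρ.IsIrreducible] [σ.IsIrreducible]
    (hne : IsEmpty (ρ.Equiv σ)) (c : ρ.IntertwiningMap ((Representation.trivial k G M).tprod σ)) :
    c = 0 := by
  classical
  let b := Module.Basis.ofVectorSpace k M
  -- coordinates along `b`: `M ⊗ W ≅ ⊕_ι W`
  let e : M ⊗[k] W ≃ₗ[k] Module.Basis.ofVectorSpaceIndex k M →₀ W :=
    (TensorProduct.congr b.repr (LinearEquiv.refl k W)).trans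
      (TensorProduct.finsuppScalarLeft k W (Module.Basis.ofVectorSpaceIndex k M))
  -- the coordinates of `c` are intertwiners `ρ → σ`, hence zero
  have hc : ∀ (i : Module.Basis.ofVectorSpaceIndex k M) (v : V), e (c v) i = 0 := by
    intro i v
    let ci : ρ.IntertwiningMap σ :=
      LinearMap.intertwiningMap_of_isIntertwiningMap ρ σ
        (Finsupp.lapply i ∘ₗ e.toLinearMap ∘ₗ c.toLinearMap) fun g v => by
          show e (c (ρ g v)) i = σ g (e (c v) i)
          rw [c.isIntertwining, trivial_tprod_apply]
          exact coordEquiv_lTensor_apply σ b i g (c v)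
    have hci : ci = 0 := Subsingleton.elim _ _
    exact congrArg (fun f : ρ.IntertwiningMap σ => f v) hci
  refine Representation.IntertwiningMap.ext (LinearMap.ext fun v => ?_)
  rw [Representation.IntertwiningMap.zero_toLinearMap, LinearMap.zero_apply,
    Representation.IntertwiningMap.toLinearMap_apply]
  have he : e (c v) = 0 := Finsupp.ext fun i => hc i v
  exact e.map_eq_zero_iff.mp he

end SchurMultiple

/-! ### Restricting `Hom_G(ρ, ⨁ p, E p)` to a set of summands -/

section Restrict

variable {V : Type uV} [AddCommGroup V] [Module k V] {ρ : Representation k G V}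
variable {H : Type uH} [AddCommGroup H] [Module k H] {τ : Representation k G H}
variable {P : Type uP} {E : P → Type uE} [∀ p, AddCommGroup (E p)] [∀ p, Module k (E p)]
variable {σ' : ∀ p, Representation k G (E p)}

/-- **Restriction to a set of summands is injective on `Hom_G(ρ, H)` when the other components vanish.**
Let `Φ : H ≃ ⨁ p, E p` be `k`-linear and `G`-equivariant (`G` acting through `σ' p` on `E p`) and `S` a set of
indices such that every intertwiner from `ρ` to a summand `σ' p`, `p ∉ S`, is zero.  Then composing with `Φ` and
the projection onto `⨁_{p ∈ S} E p` is an injective `k`-linear map `Hom_G(ρ, H) → Hom_G(ρ, ⨁_{p ∈ S} E p)`, so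
`rank Hom_G(ρ, H) ≤ rank Hom_G(ρ, ⨁_{p ∈ S} E p)` (stated with universe lifts).  (The isotypic reading of
Schur's lemma: an irreducible maps only into the summands of its own class, [Lang2002, Ch. XVII §1 Prop. 1.1].)
[cite: Lang2002, Ch. XVII §1 Prop. 1.1 (Schur's lemma)] [cite: Bump1997, Proposition 4.2.4] -/
theorem lift_rank_intertwiningMap_le_of_restrict (Φ : H ≃ₗ[k] ⨁ p, E p)
    (hΦ : ∀ (g : G) (x : H) (p : P), Φ (τ g x) p = σ' p g (Φ x p)) (S : P → Prop)
    (hvan : ∀ p, ¬ S p → ∀ c : ρ.IntertwiningMap (σ' p), c = 0) :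
    Cardinal.lift.{max uE uP uV, max uH uV} (Module.rank k (ρ.IntertwiningMap τ)) ≤
      Cardinal.lift.{max uH uV, max uE uP uV} (Module.rank k
        (ρ.IntertwiningMap (Representation.directSum fun p : {p // S p} => σ' p.1))) := by
  classical
  -- the restriction `H → ⨁_{p ∈ S} E p` as an intertwiner
  let r : (⨁ p, E p) →ₗ[k] ⨁ p : {p // S p}, E p.1 := DFinsupp.subtypeDomainLinearMap k E S
  have hr : ∀ (x : ⨁ p, E p) (p : {p // S p}), r x p = x p.1 := fun x p => rfl
  let rS : τ.IntertwiningMap (Representation.directSum fun p : {p // S p} => σ' p.1) :=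
    LinearMap.intertwiningMap_of_isIntertwiningMap _ _ (r ∘ₗ Φ.toLinearMap) fun g x => by
      refine DFinsupp.ext fun p => ?_
      show r (Φ (τ g x)) p = (Representation.directSum (fun p : {p // S p} => σ' p.1) g (r (Φ x))) p
      rw [hr, hΦ, Representation.directSum_apply, DirectSum.lmap_apply, hr]
  -- composition with `rS` is `k`-linear in the intertwiner out of `ρ` …
  let res : ρ.IntertwiningMap τ →ₗ[k]
      ρ.IntertwiningMap (Representation.directSum fun p : {p // S p} => σ' p.1) :=
    Representation.IntertwiningMap.llcomp ρ τ _ rS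
  have hres : ∀ (f : ρ.IntertwiningMap τ) (v : V) (p : {p // S p}), res f v p = Φ (f v) p.1 :=
    fun f v p => rfl
  -- … and injective: off `S` the components of `Φ ∘ f` vanish by hypothesis
  refine LinearMap.lift_rank_le_of_injective res fun f₁ f₂ hf => ?_
  rw [← sub_eq_zero] at hf ⊢
  rw [← map_sub] at hf
  set f := f₁ - f₂
  refine Representation.IntertwiningMap.ext (LinearMap.ext fun v => ?_)
  rw [Representation.IntertwiningMap.zero_toLinearMap, LinearMap.zero_apply,
    Representation.IntertwiningMap.toLinearMap_apply]
  refine Φ.injective ?_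
  rw [map_zero]
  refine DFinsupp.ext fun p => ?_
  rw [DirectSum.zero_apply]
  by_cases hp : S p
  · rw [← hres f v ⟨p, hp⟩, hf]
    rfl
  · -- the `p`-component of `Φ ∘ f` is an intertwiner `ρ → σ' p`, zero since `p ∉ S`
    let cp : ρ.IntertwiningMap (σ' p) :=
      LinearMap.intertwiningMap_of_isIntertwiningMap ρ (σ' p)
        (DirectSum.component k P E p ∘ₗ Φ.toLinearMap ∘ₗ f.toLinearMap) fun g v => by
          show DirectSum.component k P E p (Φ (f (ρ g v))) = σ' p g (DirectSum.component k P E p (Φ (f v)))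
          rw [← DirectSum.apply_eq_component, ← DirectSum.apply_eq_component, f.isIntertwining, hΦ]
    have hcp : cp v = Φ (f v) p := (DirectSum.apply_eq_component k (Φ (f v)) p).symm
    rw [← hcp, hvan p hp cp]
    rfl

end Restrict

/-! ### The sharpened multiplicity lemma -/

section Multiplicity

variable [TopologicalSpace G] [SeparatelyContinuousMul G] [IsAlgClosed k]
variable {V : Type uV} [AddCommGroup V] [Module k V] {ρ : Representation k G V}
variable {H : Type uH} [AddCommGroup H] [Module k H] {τ : Representation k G H}
variable {P : Type uP} {M : P → Type uM} [∀ p, AddCommGroup (M p)] [∀ p, Module k (M p)]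
variable {W : P → Type uW} [∀ p, AddCommGroup (W p)] [∀ p, Module k (W p)]
variable {σ : ∀ p, Representation k G (W p)}

/-- **Multiplicity at most one in a Matsushima-type decomposition, tested at one constituent.**  Let `G` be a
topological group with a compact open subgroup, `k` algebraically closed, and let `τ` on `H` be `G`-equivariantly
isomorphic to `⨁ p, (M p ⊗ W p)`, `G` acting trivially on `M p` and through the irreducible admissible pairwise
non-isomorphic `σ p` on `W p`.  Let `ρ` be irreducible and suppose `rank M p ≤ 1` for every `p` with `σ p ≅ ρ`
(by pairwise non-isomorphy there is at most one such `p`; NOTHING is assumed on the other multiplicity spaces).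
Then `rank Hom_G(ρ, τ) ≤ 1`.  (Sharpens ★ `rank_intertwiningMap_le_one_of_equivariant_directSum_tensor`, which asks
`rank M p ≤ 1` for all `p`: restrict to the summands `≅ ρ` by `lift_rank_intertwiningMap_le_of_restrict`, the other
components vanishing by `intertwiningMap_tprod_trivial_eq_zero`, then apply the ★ lemma to the restricted sum.)
[cite: BorelWallach2000, Ch. VII Thm. 3.2 and Cor. 3.4] [cite: Bump1997, Proposition 4.2.4] -/
theorem rank_intertwiningMap_le_one_of_equivariant_directSum_tensor_of_equiv [ρ.IsIrreducible]
    (Φ : H ≃ₗ[k] ⨁ p, (M p ⊗[k] W p))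
    (hΦ : ∀ (g : G) (x : H) (p : P), Φ (τ g x) p = LinearMap.lTensor (M p) (σ p g) (Φ x p))
    (hirr : ∀ p, (σ p).IsIrreducible) (hadm : ∀ p, (σ p).IsAdmissible)
    (hsep : ∀ p q, Nonempty ((σ p).Equiv (σ q)) → p = q)
    (hM : ∀ p, Nonempty ((σ p).Equiv ρ) → Module.rank k (M p) ≤ 1)
    (hK : ∃ K : Subgroup G, IsOpen (K : Set G) ∧ IsCompact (K : Set G)) :
    Module.rank k (ρ.IntertwiningMap τ) ≤ 1 := by
  -- the summand representations `1_{M p} ⊗ σ p`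
  let σ' : ∀ p, Representation k G (M p ⊗[k] W p) :=
    fun p => (Representation.trivial k G (M p)).tprod (σ p)
  have hΦ' : ∀ (g : G) (x : H) (p : P), Φ (τ g x) p = σ' p g (Φ x p) := fun g x p => by
    rw [hΦ, trivial_tprod_apply]
  -- the set of indices whose summand is `≅ ρ`; off it every component of an intertwiner vanishes
  let S : P → Prop := fun p => Nonempty ((σ p).Equiv ρ)
  have hvan : ∀ p, ¬ S p → ∀ c : ρ.IntertwiningMap (σ' p), c = 0 := by
    intro p hp c
    haveI := hirr p
    have hne : IsEmpty (ρ.Equiv (σ p)) := ⟨fun e => hp ⟨e.symm⟩⟩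
    exact intertwiningMap_tprod_trivial_eq_zero (σ p) hne c
  have h1 := lift_rank_intertwiningMap_le_of_restrict (ρ := ρ) (τ := τ) Φ hΦ' S hvan
  -- on the restricted sum every multiplicity space has rank `≤ 1`: the ★ lemma applies
  have h2 : Module.rank k
      (ρ.IntertwiningMap (Representation.directSum fun p : {p // S p} => σ' p.1)) ≤ 1 := by
    refine rank_intertwiningMap_le_one_of_equivariant_directSum_tensor (ρ := ρ)
      (M := fun p : {p // S p} => M p.1) (W := fun p : {p // S p} => W p.1)
      (σ := fun p : {p // S p} => σ p.1) (LinearEquiv.refl k _) (fun g x p => ?_)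
      (fun p => hirr p.1) (fun p => hadm p.1) (fun p q hpq => Subtype.ext (hsep p.1 q.1 hpq))
      (fun p => hM p.1 p.2) hK
    rw [LinearEquiv.refl_apply, LinearEquiv.refl_apply, Representation.directSum_apply,
      DirectSum.lmap_apply, trivial_tprod_apply]
  have h3 := h1.trans (Cardinal.lift_le_one_iff.mpr h2)
  exact Cardinal.lift_le_one_iff.mp h3

/-- The `finrank` form of `rank_intertwiningMap_le_one_of_equivariant_directSum_tensor_of_equiv`:
`dim_k Hom_G(ρ, τ) ≤ 1`, the rank bound being assumed only on the summands `≅ ρ`.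
[cite: BorelWallach2000, Ch. VII Thm. 3.2 and Cor. 3.4] [cite: Bump1997, Proposition 4.2.4] -/
theorem finrank_intertwiningMap_le_one_of_equivariant_directSum_tensor_of_equiv [ρ.IsIrreducible]
    (Φ : H ≃ₗ[k] ⨁ p, (M p ⊗[k] W p))
    (hΦ : ∀ (g : G) (x : H) (p : P), Φ (τ g x) p = LinearMap.lTensor (M p) (σ p g) (Φ x p))
    (hirr : ∀ p, (σ p).IsIrreducible) (hadm : ∀ p, (σ p).IsAdmissible)
    (hsep : ∀ p q, Nonempty ((σ p).Equiv (σ q)) → p = q)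
    (hM : ∀ p, Nonempty ((σ p).Equiv ρ) → Module.rank k (M p) ≤ 1)
    (hK : ∃ K : Subgroup G, IsOpen (K : Set G) ∧ IsCompact (K : Set G)) :
    Module.finrank k (ρ.IntertwiningMap τ) ≤ 1 := by
  have h := rank_intertwiningMap_le_one_of_equivariant_directSum_tensor_of_equiv (ρ := ρ) (τ := τ) Φ hΦ
    hirr hadm hsep hM hK
  exact Module.finrank_le_of_rank_le (by exact_mod_cast h)

end Multiplicity

end MatsushimaMultiplicity

end Literature.RepresentationTheory

end
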